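import Literature.Computability.MetaComplexity.EFSoundness
import Literature.Computability.MetaComplexity.FregeProofs
import Literature.Computability.Complexity.TautCertificates
import HarnessLib

/-!
# The Pich–Santhanam witnessing formulas `w^{k,u}_n(f)` and the systems `EF + w`

Topic `Literature/Computability/MetaComplexity` (definition request `psWitnessFormula`, for the
lens route SelfProvingEF of `Summits/PneNP`). Source: J. Pich, R. Santhanam, *Towards P ≠ NP
from Extended Frege lower bounds*, J. ACM 73 (2026) 12:1–27 [PichSanthanam2026]
(= arXiv:2312.08163 [PichSanthanam2023]), §1.2 pp. 6–7 and §3.2 p. 22 ("Restricting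
nonuniformity", Theorem 19 and Corollary 20).

## Content

1. **Extended Frege with extra axioms** (`EF + Γ`). Pich–Santhanam, p. 7: "we could define an
   extension of EF, denoted `EF + w^k(f)`, such that `EF + w^k(f)` proofs are EF-proofs which are,
   in addition, allowed to derive substitutional instances of `w^k_n(f)`, for `n > n₀`". Over a
   rule list `F` (`FregeSystem`, `Frege.lean`):
   * `FregeSystem.IsEFDerivationFrom Γ φ π`, `FregeSystem.IsEFProofFromOf Γ π φ`,
     `FregeSystem.EFProvableFrom Γ φ` — extended-Frege derivations/proofs whose lines may also be
     members of the axiom set `Γ` (generalising `FregeSystem.IsEFDerivation`, the case `Γ = ∅`: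
     `isEFDerivationFrom_empty`);
   * `FregeSystem.IsEFPolyBoundedFrom Γ` — "`EF + Γ` is p-bounded" (Cook–Reckhow's Def. 1.3 for
     this system; `isEFPolyBoundedFrom_empty`);
   * `substInstances A` (all substitution instances of members of `A`) and
     `efPlus w n₀ = substInstances {w n | n > n₀}` — the axiom set of `EF + w` for a sequence of
     formulas `w : ℕ → PropForm ℕ` (also the shape of `EF + tt(h)`, `EF + α` of the same paper);
   * API: monotonicity in `Γ`, `EF ⊆ EF + Γ`, one-line proofs of axioms, closure of `efPlus`
     under substitution, and **soundness** (`IsSound.isTautology_of_isEFProofFromOf`: over sound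
     rules and tautological axioms `EF + Γ` proves only tautologies; reduced to Cook–Reckhow's
     Prop. 4.2, `EFSoundness.lean`, by adjoining the finitely many axioms used as premise-free
     rules).
2. **The witnessing formulas, encoding-generically.** The printed definition (arXiv p. 3; J. ACM
   p. 6 for the prose) is
   `w^k_n(f) := [SAT_n(x,y) → SAT_n(x,C(x))] ∨ [SAT_n(f₁(C),f₂(C)) ∧ ¬SAT_n(f₁(C),C(f₁(C)))]`,
   "`SAT_n(x,y)` … saying that `x` is an `n`-bit string encoding a propositional formula satisfied
   by assignment `y`, `C(z)` says that free variables `C` represent a circuit … which outputs `C(z)`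
   on `z`, and `f(C)` outputs a pair of strings `⟨f₁(C), f₂(C)⟩`. **We do not specify the precise
   encoding of `w^k_n(f)`.** The proof systems we work with simulate EF and are therefore strong
   enough to reason efficiently with any natural encoding". In the uniform variant `w^{k,u}_n(f)`
   (p. 22) the circuit `C` is "a hardwired description of a fixed universal Turing machine `U`"
   run for `n^k` steps on an algorithm description-plus-advice `A` of `⌊log n⌋ + u(n)` bits, given
   by free variables, and the input. Accordingly the formula is defined here PARAMETRICALLY in
   the three propositional encodings it is assembled from, each a formula over a structured
   variable type:
   * `RunVar ι o = ι ⊕ o ⊕ ℕ` — input bits `ι`, output bits `o`, auxiliary variables `ℕ` — and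
     `DefinesMap R g` — the formula `R : PropForm (RunVar ι o)` *defines* the Boolean map
     `g : (ι → Bool) → (o → Bool)`: every satisfying assignment carries `g (inputs)` on the output
     variables, and every input vector extends to a satisfying assignment (Cook's propositional
     description of a computation with free input cells, Cook 1971 Thm 1 / Krajíček 1995 §9.2);
   * the data: `RU : PropForm (RunVar (Fin ℓ ⊕ Fin c) (Fin n))` (the run of `U` on `(A, X)`,
     output `C(X)`, used twice), `RF : PropForm (RunVar (Fin ℓ) (Fin c ⊕ Fin n))` (the run of the
     machine of `f` on `A`, the constant input `1ⁿ` being absorbed, outputs `(f₁, f₂)`), and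
     `S : PropForm (Fin c ⊕ Fin n)` (the formula `SAT_n(X, Y)` on a `c`-bit code and an `n`-bit
     assignment);
   * `WVar ℓ c n` — the variable blocks `A, X, Y, C(X), f₁, f₂, C(f₁)` and three auxiliary blocks —
     with the explicit injective layout `WVar.toNat` (`10 · payload + tag`, left inverse
     `WVar.ofNat`); the block maps `WVar.run₁`, `WVar.run₂`, `WVar.run₃`, `WVar.satXY`, …;
   * `psWitnessFormW RU RF S : PropForm (WVar ℓ c n)` and
     **`psWitnessForm RU RF S : PropForm ℕ`** `= (R₁ ∧ R₂ ∧ R₃) → ([S(X,Y) → S(X,C(X))] ∨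
     [S(f₁,f₂) ∧ ¬ S(f₁,C(f₁))])`;
   * the semantics `SearchSATWitnessing sat gU gF` (for every description `a`, formula code `x`
     and assignment `y`: if `y` satisfies `x` then so does `U(a,x)`, or `f(a) = (f₁, f₂)` with
     `f₂ ⊨ f₁` and `U(a, f₁) ⊭ f₁`) and the theorem **`isTautology_psWitnessForm_iff`**:
     under `DefinesMap RU gU`, `DefinesMap RF gF` and `S` expressing `sat`, `psWitnessForm RU RF S`
     is a tautology iff `SearchSATWitnessing sat gU gF`; `size_psWitnessForm` (linear in the
     sizes of `RU, RF, S`).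
3. **Corollary 20, encoding-generic, as a named fact** `PSUniformSelfProvability` over a
   `WitnessingFrame` (the family `n ↦ (RU n, RF n, S n)` with its intended semantics), unified
   over a substitution-closed axiom set `Γ` (item 1 of Cor. 20 is `Γ = efPlus w n₀`, item 2 is
   `Γ = ∅`, derived as `PSUniformSelfProvability.cor20_1/2`), with the conclusion in the form the
   printed proof yields ("no description-plus-advice sequence `a` makes `U(a, ·)` solve search-SAT
   at all large lengths") and with the SAT-adequacy step of the printed proof ("To prove a
   tautology `φ` of size `n` in `EF + w^k(f)` it suffices to check out that `¬SAT_n(¬φ, C(¬φ))`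
   (which implies that `SAT_n(φ, y)` and `φ` hold)", p. 22) as the explicit hypothesis
   `WitnessingFrame.SatAdequate`, since for an abstract encoding `S` it is not automatic.

## Instantiation (for the companion items `runForm`, `satMatrixForm`)

With `runForm` (Cook–Levin tableau of a clocked deterministic run with free input cells and
exposed output cells) and `satMatrixForm n` (matrix-code `SAT_n`) landed, `w^{k,u}_n(f)` of the
request is `psWitnessForm (RU n) (RF n) (S n)` with `ℓ = ⌊log₂ n⌋ + u n`, `c = 2n²`,
`RU n :=` the run formula of a TM2 machine `M_U` computing `UniversalMachine.run` (field
`polyTime` of `UniversalMachine.lean`) on `boolPair A X` with budget `n^k`, relabelled into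
`RunVar (Fin ℓ ⊕ Fin c) (Fin n)` (input cell "bit `j` is `true`" ↦ `inl`, output cell ↦
`inr (inl ·)`, every other tableau variable injectively ↦ `inr (inr ·)`), `RF n :=` likewise for
the machine of `f` on `boolPair A 1ⁿ`, and `S n := satMatrixForm n` read over `Fin c ⊕ Fin n`.
The choice of `M_U` is immaterial for Cor. 20: its proof only EVALUATES closed instances of the
run formulas (every `DefinesMap` encoding of the same map will do), which is why the definitions
below never mention machines.

## Sources

* [PichSanthanam2026] J. Pich, R. Santhanam, J. ACM 73(2) (2026), Art. 12: §1.2 pp. 6–7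
  (`w^k_n(f)`, `EF + w^k(f)`, Thm 3), §3.2 p. 22 (Thm 19 with proof; "Restricting nonuniformity";
  Cor. 20). [PichSanthanam2023] arXiv:2312.08163, §1.1.1 p. 3 (displayed formula), Cor. 2.
* [CookReckhow1979] S. A. Cook, R. A. Reckhow, J. Symb. Logic 44 (1979), §4 (extended Frege),
  Prop. 4.2 (soundness), Def. 1.3 (polynomially bounded).
* [Krajicek1995] J. Krajíček, *Bounded arithmetic, propositional logic, and complexity theory*,
  CUP 1995, Def. 4.5.2 (EF), §9.2, Def. 9.2.1 (the translation `‖·‖`: atomic polynomial-time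
  relations become polynomial-size formulas with auxiliary atoms).

## Design notes / not here

* Heterogeneous substitution `PropForm.bind` (variables of type `ν` replaced by formulas over
  `μ`) is added to G01's `PropForm` namespace as a deliberate dot-extension, with `subst`/`mapVars`
  as special cases; it is needed to state SAT-adequacy without reference to a variable layout.
* Implication is written `disj (neg a) b` (the file does not import `ParisWilkie.lean`).
* Not here: the concrete encodings (`runForm`, `satMatrixForm`: separate definition items), the
  bounded-arithmetic form `S¹₂ ⊢ W^{k,u}_{n₀}(f)` of Cor. 20(2) (the paper itself offers p-size
  EF proofs as the equivalent reading, p. 7), the translation of the conclusion into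
  `Time[n^{Ω(k)}]/u(n)` for multitape machines (which needs a uniform-overhead universal
  machine; the tree's `UniversalMachine.sim` has machine-dependent overhead), and a proof of
  `PSUniformSelfProvability` (substitution of constants into `EF + Γ` proofs, evaluation of
  closed formulas, renaming of extension variables: Cook–Reckhow §4 technology).
-/

namespace Literature.Computability.Complexity.PropForm

/-! ### Heterogeneous substitution -/

universe u v w

variable {ν : Type u} {μ : Type v}

/-- Heterogeneous simultaneous substitution (the monadic bind of the syntax tree): `φ.bind σ`
replaces every variable `x : ν` of `φ` by the formula `σ x` over another variable type `μ`.
`PropForm.subst` (`σ : ν → PropForm ν`) and `PropForm.mapVars` (`σ = var ∘ f`) are special cases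
(`subst_eq_bind`, `mapVars_eq_bind`). (Dot-extension of G01's
`Literature.Computability.Complexity.PropForm`.) [folklore] -/
def bind (σ : ν → PropForm μ) : PropForm ν → PropForm μ
  | var x => σ x
  | const b => const b
  | neg φ => neg (φ.bind σ)
  | conj φ ψ => conj (φ.bind σ) (ψ.bind σ)
  | disj φ ψ => disj (φ.bind σ) (ψ.bind σ)

/-- Evaluation commutes with heterogeneous substitution. [folklore] -/
@[simp] theorem eval_bind (σ : ν → PropForm μ) (τ : μ → Bool) (φ : PropForm ν) :
    (φ.bind σ).eval τ = φ.eval fun x => (σ x).eval τ := by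
  induction φ <;> simp_all [bind, eval]

/-- Homogeneous substitution is a `bind`. [folklore] -/
theorem subst_eq_bind (σ : ν → PropForm ν) (φ : PropForm ν) : φ.subst σ = φ.bind σ := by
  induction φ <;> simp_all [bind, subst]

/-- Relabelling is a `bind` by variables. [folklore] -/
theorem mapVars_eq_bind (f : ν → μ) (φ : PropForm ν) :
    φ.mapVars f = φ.bind fun x => var (f x) := by
  induction φ <;> simp_all [bind, mapVars]

/-- Associativity of `bind`. [folklore] -/
theorem bind_bind {κ : Type w} (σ : ν → PropForm μ) (τ : μ → PropForm κ) (φ : PropForm ν) :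
    (φ.bind σ).bind τ = φ.bind fun x => (σ x).bind τ := by
  induction φ <;> simp_all [bind]

/-- Substituting into a relabelled formula. [folklore] -/
theorem subst_mapVars (f : ν → μ) (σ : μ → PropForm μ) (φ : PropForm ν) :
    (φ.mapVars f).subst σ = φ.bind fun x => σ (f x) := by
  rw [mapVars_eq_bind, subst_eq_bind, bind_bind]
  simp [bind]

/-- A tautology stays a tautology under relabelling of its variables. [folklore] -/
theorem IsTautology.mapVars {φ : PropForm ν} (h : φ.IsTautology) (f : ν → μ) :
    (φ.mapVars f).IsTautology :=
  fun τ => by rw [eval_mapVars]; exact h _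

/-- Relabelling along a map with a left inverse preserves and reflects tautologies. [folklore] -/
theorem isTautology_mapVars_iff {f : ν → μ} {g : μ → ν} (hgf : ∀ x, g (f x) = x)
    (φ : PropForm ν) : (φ.mapVars f).IsTautology ↔ φ.IsTautology := by
  refine ⟨fun h σ => ?_, fun h => h.mapVars f⟩
  have := h (σ ∘ g)
  rw [eval_mapVars] at this
  rw [← this]
  congr 1
  funext x
  simp [hgf]

end Literature.Computability.Complexity.PropForm

namespace Literature.Computability.MetaComplexity

open Complexity Complexity.PropForm

/-! ## 1. Extended Frege with an axiom set: `EF + Γ`, `EF + w` -/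

namespace FregeSystem

variable (F : FregeSystem)

/-- `F.IsEFDerivationFrom Γ φ π`: `π` is an extended-Frege derivation over the rule list `F`
*from the axiom set* `Γ`, relative to the target formula `φ`: every line is a member of `Γ`, or is
inferred by a rule instance from earlier lines, or is an extension axiom `p ↔ ψ` with `p` fresh
(not in `ψ`, `φ`, or earlier lines). For `Γ = ∅` this is `F.IsEFDerivation φ π`
(`isEFDerivationFrom_empty`); for `Γ =` the substitution instances of the formulas `w_n`,
`n > n₀`, it is a derivation in Pich–Santhanam's system `EF + w` ("EF-proofs which are, in
addition, allowed to derive substitutional instances of `w^k_n(f)`, for `n > n₀`").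
[cite: PichSanthanam2026, §1.2 p. 7 (definition of EF + w^k(f))] -/
def IsEFDerivationFrom (Γ : Set (PropForm ℕ)) (φ : PropForm ℕ) (π : List (PropForm ℕ)) : Prop :=
  ∀ (k : ℕ) (hk : k < π.length),
    π[k] ∈ Γ ∨ F.IsInferred (π.take k) π[k] ∨ IsExtensionAxiom φ (π.take k) π[k]

/-- `F.IsEFProofFromOf Γ π φ`: `π` is an `EF + Γ` proof of `φ` over `F` — an extended-Frege
derivation from the axioms `Γ` whose last line is `φ`.
[cite: PichSanthanam2026, §1.2 p. 7 (EF + w^k(f) proofs)] -/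
def IsEFProofFromOf (Γ : Set (PropForm ℕ)) (π : List (PropForm ℕ)) (φ : PropForm ℕ) : Prop :=
  F.IsEFDerivationFrom Γ φ π ∧ π.getLast? = some φ

/-- `F.EFProvableFrom Γ φ` (`EF + Γ ⊢ φ`): `φ` has an `EF + Γ` proof over `F`.
[cite: PichSanthanam2026, §1.2 p. 7] -/
def EFProvableFrom (Γ : Set (PropForm ℕ)) (φ : PropForm ℕ) : Prop :=
  ∃ π, F.IsEFProofFromOf Γ π φ

/-- `F.IsEFPolyBoundedFrom Γ`: the system `EF + Γ` over the rule list `F` is *polynomially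
bounded* — some polynomial `p` bounds, for every tautology `φ`, the size (`proofSize`) of a
shortest `EF + Γ` proof of `φ` by `p φ.size` (Cook–Reckhow's Def. 1.3 for this system; for
`Γ = ∅` it is `F.IsEFPolyBounded`, `isEFPolyBoundedFrom_empty`). A definition in hypothesis form
with explicit binders, like `FregeSystem.IsEFPolyBounded`: Pich–Santhanam's "if `EF + w^k(f)` is
not p-bounded" is `¬ F.IsEFPolyBoundedFrom (efPlus w n₀)`.
[cite: PichSanthanam2026, Thm 3 / Thm 19 (1) ("EF + w^k(f) is not p-bounded")] -/
def IsEFPolyBoundedFrom (F : FregeSystem) (Γ : Set (PropForm ℕ)) : Prop :=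
  ∃ p : Polynomial ℕ, ∀ φ : PropForm ℕ, φ.IsTautology →
    ∃ π, F.IsEFProofFromOf Γ π φ ∧ proofSize π ≤ p.eval φ.size

end FregeSystem

/-- The set of all substitution instances `ψ.subst σ` of members `ψ` of `A`.
[cite: PichSanthanam2026, §1.2 p. 7 ("substitutional instances of w^k_n(f)")] -/
def substInstances (A : Set (PropForm ℕ)) : Set (PropForm ℕ) :=
  {θ | ∃ ψ ∈ A, ∃ σ : ℕ → PropForm ℕ, θ = ψ.subst σ}

/-- `efPlus w n₀`: the axiom set of Pich–Santhanam's proof system `EF + w` for a sequence of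
formulas `w : ℕ → PropForm ℕ` and a threshold `n₀` — all substitution instances of the formulas
`w n`, `n > n₀` ("`EF + w^k(f)` proofs are EF-proofs which are, in addition, allowed to derive
substitutional instances of `w^k_n(f)`, for `n > n₀`"; the same shape defines `EF + w^{k,u}(f)`,
p. 22, and `EF + α^{s}` of Thm 5). `EF + w ⊢ φ` is `F.EFProvableFrom (efPlus w n₀) φ` and
"`EF + w` is p-bounded" is `F.IsEFPolyBoundedFrom (efPlus w n₀)`.
[cite: PichSanthanam2026, §1.2 p. 7 (definition of EF + w^k(f)), §3.2 p. 22 (EF + w^{k,u}(f))] -/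
def efPlus (w : ℕ → PropForm ℕ) (n₀ : ℕ) : Set (PropForm ℕ) :=
  substInstances {ψ | ∃ n, n₀ < n ∧ ψ = w n}

/-! ### API for `EF + Γ` -/

section SubstInstances

variable {A : Set (PropForm ℕ)} {ψ θ : PropForm ℕ} {w : ℕ → PropForm ℕ} {n₀ n : ℕ}

/-- A member of `A` is a substitution instance of itself (`σ = var`). [folklore] -/
theorem mem_substInstances_of_mem (h : ψ ∈ A) : ψ ∈ substInstances A :=
  ⟨ψ, h, var, (subst_var ψ).symm⟩

/-- `substInstances A` is closed under substitution. [folklore] -/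
theorem subst_mem_substInstances (h : θ ∈ substInstances A) (σ : ℕ → PropForm ℕ) :
    θ.subst σ ∈ substInstances A := by
  obtain ⟨ψ, hψ, τ, rfl⟩ := h
  exact ⟨ψ, hψ, fun x => (τ x).subst σ, subst_subst τ σ ψ⟩

/-- Substitution instances of tautologies are tautologies. [cite: CookReckhow1979, §2] -/
theorem isTautology_of_mem_substInstances (hA : ∀ ψ ∈ A, ψ.IsTautology)
    (h : θ ∈ substInstances A) : θ.IsTautology := by
  obtain ⟨ψ, hψ, σ, rfl⟩ := h
  exact (hA ψ hψ).subst σ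

/-- The formula `w n`, `n > n₀`, is an axiom of `EF + w`. [cite: PichSanthanam2026, §1.2 p. 7] -/
theorem mem_efPlus (h : n₀ < n) : w n ∈ efPlus w n₀ :=
  mem_substInstances_of_mem ⟨n, h, rfl⟩

/-- The axiom set of `EF + w` is closed under substitution. [cite: PichSanthanam2026, §1.2 p. 7] -/
theorem subst_mem_efPlus (h : θ ∈ efPlus w n₀) (σ : ℕ → PropForm ℕ) : θ.subst σ ∈ efPlus w n₀ :=
  subst_mem_substInstances h σ

/-- If the formulas `w n`, `n > n₀`, are tautologies then so is every axiom of `EF + w` (the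
standing hypothesis under which Pich–Santhanam introduce `EF + w^k(f)`).
[cite: PichSanthanam2026, §1.2 p. 7 ("If we had a function f such that … w^k_n(f) would be a tautology")] -/
theorem isTautology_of_mem_efPlus (hw : ∀ n, n₀ < n → (w n).IsTautology) :
    ∀ θ ∈ efPlus w n₀, θ.IsTautology :=
  fun _ hθ => isTautology_of_mem_substInstances (by rintro _ ⟨n, hn, rfl⟩; exact hw n hn) hθ

end SubstInstances

namespace FregeSystem

variable {F : FregeSystem} {Γ Γ' : Set (PropForm ℕ)} {π : List (PropForm ℕ)} {φ : PropForm ℕ}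

/-- `EF + ∅` derivations are the `EF` derivations of `Frege.lean`. [cite: CookReckhow1979, §4] -/
theorem isEFDerivationFrom_empty : F.IsEFDerivationFrom ∅ φ π ↔ F.IsEFDerivation φ π := by
  simp [IsEFDerivationFrom, IsEFDerivation]

/-- `EF + ∅` proofs are `EF` proofs. [cite: CookReckhow1979, §4] -/
theorem isEFProofFromOf_empty : F.IsEFProofFromOf ∅ π φ ↔ F.IsEFProofOf π φ := by
  rw [IsEFProofFromOf, isEFDerivationFrom_empty, IsEFProofOf]

/-- Polynomial boundedness of `EF + ∅` is that of `EF`. [cite: CookReckhow1979, §1 Def. 1.3, §4] -/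
theorem isEFPolyBoundedFrom_empty : F.IsEFPolyBoundedFrom ∅ ↔ F.IsEFPolyBounded := by
  simp only [IsEFPolyBoundedFrom, IsEFPolyBounded, isEFProofFromOf_empty]

/-- Derivations are monotone in the axiom set. [folklore] -/
theorem IsEFDerivationFrom.mono (h : F.IsEFDerivationFrom Γ φ π) (hΓ : Γ ⊆ Γ') :
    F.IsEFDerivationFrom Γ' φ π :=
  fun k hk => (h k hk).imp (fun hm => hΓ hm) id

/-- Proofs are monotone in the axiom set. [folklore] -/
theorem IsEFProofFromOf.mono (h : F.IsEFProofFromOf Γ π φ) (hΓ : Γ ⊆ Γ') :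
    F.IsEFProofFromOf Γ' π φ :=
  ⟨h.1.mono hΓ, h.2⟩

/-- Polynomial boundedness is monotone in the axiom set. [folklore] -/
theorem IsEFPolyBoundedFrom.mono (h : F.IsEFPolyBoundedFrom Γ) (hΓ : Γ ⊆ Γ') :
    F.IsEFPolyBoundedFrom Γ' := by
  obtain ⟨p, hp⟩ := h
  exact ⟨p, fun φ hφ => (hp φ hφ).imp fun π hπ => ⟨hπ.1.mono hΓ, hπ.2⟩⟩

/-- An `EF` derivation is an `EF + Γ` derivation (using no axioms). [cite: CookReckhow1979, §4] -/
theorem IsEFDerivation.isEFDerivationFrom (h : F.IsEFDerivation φ π) (Γ : Set (PropForm ℕ)) :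
    F.IsEFDerivationFrom Γ φ π :=
  (isEFDerivationFrom_empty.2 h).mono (Set.empty_subset Γ)

/-- An `EF` proof is an `EF + Γ` proof. [cite: CookReckhow1979, §4] -/
theorem IsEFProofOf.isEFProofFromOf (h : F.IsEFProofOf π φ) (Γ : Set (PropForm ℕ)) :
    F.IsEFProofFromOf Γ π φ :=
  (isEFProofFromOf_empty.2 h).mono (Set.empty_subset Γ)

/-- If `EF` is polynomially bounded then so is `EF + Γ`. [cite: CookReckhow1979, §1 Def. 1.3, §4] -/
theorem IsEFPolyBounded.isEFPolyBoundedFrom (h : F.IsEFPolyBounded) (Γ : Set (PropForm ℕ)) :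
    F.IsEFPolyBoundedFrom Γ :=
  (isEFPolyBoundedFrom_empty.2 h).mono (Set.empty_subset Γ)

/-- An axiom is proved by the one-line proof consisting of itself (so `EF + w` proves `w n`,
`n > n₀`, in size `(w n).size`). [cite: PichSanthanam2026, §1.2 p. 7] -/
theorem isEFProofFromOf_singleton (h : φ ∈ Γ) : F.IsEFProofFromOf Γ [φ] φ :=
  ⟨fun k hk => by
    simp only [List.length_singleton, Nat.lt_one_iff] at hk
    subst hk
    exact Or.inl (by simpa using h), rfl⟩

/-- **Soundness of `EF + Γ`**: over a sound rule list, if every axiom in `Γ` is a tautology then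
every `EF + Γ`-provable formula is a tautology. Proof: the finitely many axioms occurring in the
proof are adjoined to `F` as premise-free (sound) rules, turning the `EF + Γ` proof into an
`EF` proof over a sound rule list, to which Cook–Reckhow's Prop. 4.2
(`IsSound.isTautology_of_isEFProofOf`, `EFSoundness.lean`) applies. In particular `EF + w` is
sound as soon as the `w n`, `n > n₀`, are tautologies (`isTautology_of_mem_efPlus`).
[cite: CookReckhow1979, Prop. 4.2] -/
theorem IsSound.isTautology_of_isEFProofFromOf (hF : F.IsSound) (hΓ : ∀ ψ ∈ Γ, ψ.IsTautology)
    (h : F.IsEFProofFromOf Γ π φ) : φ.IsTautology := by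
  classical
  -- adjoin the axioms used in `π` as premise-free rules
  let F' : FregeSystem := ⟨F.rules ++ (π.filter fun θ => θ ∈ Γ).map fun θ => ⟨[], θ⟩⟩
  have hF' : F'.IsSound := by
    intro r hr
    rcases List.mem_append.1 hr with hr | hr
    · exact hF r hr
    · obtain ⟨θ, hθ, rfl⟩ := List.mem_map.1 hr
      have hθΓ : θ ∈ Γ := by simpa using (List.mem_filter.1 hθ).2
      intro σ _
      exact hΓ θ hθΓ σ
  have hπ : F'.IsEFProofOf π φ := by
    refine ⟨fun k hk => ?_, h.2⟩
    rcases h.1 k hk with hm | ⟨r, hr, σ, hc, hp⟩ | hext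
    · refine Or.inl ⟨⟨[], π[k]⟩, ?_, var, by simp, by simp⟩
      refine List.mem_append_right _ (List.mem_map.2 ⟨π[k], ?_, rfl⟩)
      exact List.mem_filter.2 ⟨List.getElem_mem hk, by simpa using hm⟩
    · exact Or.inl ⟨r, List.mem_append_left _ hr, σ, hc, hp⟩
    · exact Or.inr hext
  exact hF'.isTautology_of_isEFProofOf hπ

/-- Hence, over a sound rule list and tautological axioms, `EF + Γ` provability implies
tautologyhood. [cite: CookReckhow1979, Prop. 4.2] -/
theorem IsSound.isTautology_of_efProvableFrom (hF : F.IsSound) (hΓ : ∀ ψ ∈ Γ, ψ.IsTautology)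
    (h : F.EFProvableFrom Γ φ) : φ.IsTautology := by
  obtain ⟨π, hπ⟩ := h
  exact hF.isTautology_of_isEFProofFromOf hΓ hπ

end FregeSystem

/-! ## 2. The witnessing formulas -/

/-! ### Propositional definitions of Boolean maps -/

/-- The variables of a propositional encoding of a run (a "formula encoding `h(x) = b` with free
variables `x`", Pich–Santhanam Lemma 23 / §3.2; Cook's description of a computation): input bits
indexed by `ι` (`Sum.inl`), output bits indexed by `o` (`Sum.inr ∘ Sum.inl`) and countably many
auxiliary (work-tape / tableau) variables (`Sum.inr ∘ Sum.inr`). [folklore] -/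
abbrev RunVar (ι o : Type) : Type := ι ⊕ o ⊕ ℕ

/-- `DefinesMap R g`: the formula `R` over `RunVar ι o` is a propositional definition of the
Boolean map `g : (ι → Bool) → (o → Bool)` — (soundness) under every satisfying assignment the
output variables carry `g` of the input variables, and (completeness) every assignment of the
input variables extends to a satisfying assignment. This is exactly what is used of the
encodings `C(z)`, `f(C)` in `w^k_n(f)` (Cook 1971, Thm 1, for a deterministic machine with free
input cells; Krajíček 1995, §9.2, Def. 9.2.1). [cite: PichSanthanam2026, §1.2 p. 6 ("C(z) says that free variables C represent a circuit … which outputs C(z) on z")] -/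
def DefinesMap {ι o : Type} (R : PropForm (RunVar ι o)) (g : (ι → Bool) → o → Bool) : Prop :=
  (∀ τ : RunVar ι o → Bool, R.eval τ = true →
      ∀ i : o, τ (Sum.inr (Sum.inl i)) = g (fun j => τ (Sum.inl j)) i) ∧
  (∀ x : ι → Bool, ∃ τ : RunVar ι o → Bool, R.eval τ = true ∧ ∀ j, τ (Sum.inl j) = x j)

/-! ### The variable layout of `w^{k,u}_n(f)` -/

/-- The variables of the witnessing formula `w^{k,u}_n(f)` with description block of length `ℓ`
(`= ⌊log n⌋ + u(n)`: algorithm description and advice `A`), formula codes of length `c` and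
assignments of length `n`: the blocks `A` (`alg`), `X` (`inp`, the input formula code), `Y`
(`asg`), `C(X)` (`out`, output of the first run of `U`), `f₁(C)` (`witInp`, the witness formula
code) and `f₂(C)` (`witAsg`, output blocks of the run of `f`), `C(f₁(C))` (`witOut`, output of the
second run of `U`), and the auxiliary variables of the three runs (`aux₁`, `aux₂`, `aux₃`).
[cite: PichSanthanam2026, §1.2 p. 6 and §3.2 p. 22 ("The algorithm A and its nonuniform advice are described by free variables")] -/
inductive WVar (ℓ c n : ℕ) : Type
  /-- bit `j` of the algorithm description-plus-advice `A` -/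
  | alg (j : Fin ℓ)
  /-- bit `i` of the input formula code `X` -/
  | inp (i : Fin c)
  /-- bit `j` of the assignment `Y` -/
  | asg (j : Fin n)
  /-- bit `j` of `C(X)`, the output of `U` on `(A, X)` -/
  | out (j : Fin n)
  /-- bit `i` of `f₁(C)`, the formula code output by `f` on `A` -/
  | witInp (i : Fin c)
  /-- bit `j` of `f₂(C)`, the assignment output by `f` on `A` -/
  | witAsg (j : Fin n)
  /-- bit `j` of `C(f₁(C))`, the output of `U` on `(A, f₁(C))` -/
  | witOut (j : Fin n)
  /-- auxiliary variable `v` of the run of `U` on `(A, X)` -/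
  | aux₁ (v : ℕ)
  /-- auxiliary variable `v` of the run of `f` on `A` -/
  | aux₂ (v : ℕ)
  /-- auxiliary variable `v` of the run of `U` on `(A, f₁(C))` -/
  | aux₃ (v : ℕ)
  deriving DecidableEq

namespace WVar

variable {ℓ c n : ℕ}

/-- Block map of the first run: `U` on input `(A, X)` with output `C(X)`. [cite: PichSanthanam2026, §3.2 p. 22] -/
def run₁ : RunVar (Fin ℓ ⊕ Fin c) (Fin n) → WVar ℓ c n
  | Sum.inl (Sum.inl j) => alg j
  | Sum.inl (Sum.inr i) => inp i
  | Sum.inr (Sum.inl j) => out j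
  | Sum.inr (Sum.inr v) => aux₁ v

/-- Block map of the second run: `f` on input `A` with outputs `(f₁(C), f₂(C))`. [cite: PichSanthanam2026, §3.2 p. 22] -/
def run₂ : RunVar (Fin ℓ) (Fin c ⊕ Fin n) → WVar ℓ c n
  | Sum.inl j => alg j
  | Sum.inr (Sum.inl (Sum.inl i)) => witInp i
  | Sum.inr (Sum.inl (Sum.inr j)) => witAsg j
  | Sum.inr (Sum.inr v) => aux₂ v

/-- Block map of the third run: `U` on input `(A, f₁(C))` with output `C(f₁(C))`. [cite: PichSanthanam2026, §3.2 p. 22] -/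
def run₃ : RunVar (Fin ℓ ⊕ Fin c) (Fin n) → WVar ℓ c n
  | Sum.inl (Sum.inl j) => alg j
  | Sum.inl (Sum.inr i) => witInp i
  | Sum.inr (Sum.inl j) => witOut j
  | Sum.inr (Sum.inr v) => aux₃ v

/-- Block map of `SAT_n(X, Y)`. [cite: PichSanthanam2026, §1.2 p. 6] -/
def satXY : Fin c ⊕ Fin n → WVar ℓ c n := Sum.elim inp asg

/-- Block map of `SAT_n(X, C(X))`. [cite: PichSanthanam2026, §1.2 p. 6] -/
def satXO : Fin c ⊕ Fin n → WVar ℓ c n := Sum.elim inp out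

/-- Block map of `SAT_n(f₁(C), f₂(C))`. [cite: PichSanthanam2026, §1.2 p. 6] -/
def satW : Fin c ⊕ Fin n → WVar ℓ c n := Sum.elim witInp witAsg

/-- Block map of `SAT_n(f₁(C), C(f₁(C)))`. [cite: PichSanthanam2026, §1.2 p. 6] -/
def satWO : Fin c ⊕ Fin n → WVar ℓ c n := Sum.elim witInp witOut

/-- The layout of the variables of `w^{k,u}_n(f)` in `ℕ`: `10 · payload + tag` with tags
`0, …, 9` for the ten blocks (an arbitrary but fixed "natural encoding", as the source allows).
[cite: PichSanthanam2026, §1.2 p. 6 ("We do not specify the precise encoding")] -/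
def toNat : WVar ℓ c n → ℕ
  | alg j => 10 * j
  | inp i => 10 * i + 1
  | asg j => 10 * j + 2
  | out j => 10 * j + 3
  | witInp i => 10 * i + 4
  | witAsg j => 10 * j + 5
  | witOut j => 10 * j + 6
  | aux₁ v => 10 * v + 7
  | aux₂ v => 10 * v + 8
  | aux₃ v => 10 * v + 9

/-- A total decoder for the layout `toNat` (junk values outside its range). [folklore] -/
def ofNat (k : ℕ) : WVar ℓ c n :=
  if k % 10 = 0 then (if h : k / 10 < ℓ then alg ⟨k / 10, h⟩ else aux₁ 0)
  else if k % 10 = 1 then (if h : k / 10 < c then inp ⟨k / 10, h⟩ else aux₁ 0)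
  else if k % 10 = 2 then (if h : k / 10 < n then asg ⟨k / 10, h⟩ else aux₁ 0)
  else if k % 10 = 3 then (if h : k / 10 < n then out ⟨k / 10, h⟩ else aux₁ 0)
  else if k % 10 = 4 then (if h : k / 10 < c then witInp ⟨k / 10, h⟩ else aux₁ 0)
  else if k % 10 = 5 then (if h : k / 10 < n then witAsg ⟨k / 10, h⟩ else aux₁ 0)
  else if k % 10 = 6 then (if h : k / 10 < n then witOut ⟨k / 10, h⟩ else aux₁ 0)
  else if k % 10 = 7 then aux₁ (k / 10)
  else if k % 10 = 8 then aux₂ (k / 10)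
  else aux₃ (k / 10)

/-- `ofNat` is a left inverse of the layout. [folklore] -/
theorem ofNat_toNat (w : WVar ℓ c n) : ofNat (toNat w) = w := by
  cases w with
  | alg j =>
    have h1 : 10 * (j : ℕ) % 10 = 0 := by omega
    have h2 : 10 * (j : ℕ) / 10 = j := by omega
    simp [toNat, ofNat, h1, h2]
  | inp i =>
    have h1 : (10 * (i : ℕ) + 1) % 10 = 1 := by omega
    have h2 : (10 * (i : ℕ) + 1) / 10 = i := by omega
    simp [toNat, ofNat, h1, h2]
  | asg j =>
    have h1 : (10 * (j : ℕ) + 2) % 10 = 2 := by omega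
    have h2 : (10 * (j : ℕ) + 2) / 10 = j := by omega
    simp [toNat, ofNat, h1, h2]
  | out j =>
    have h1 : (10 * (j : ℕ) + 3) % 10 = 3 := by omega
    have h2 : (10 * (j : ℕ) + 3) / 10 = j := by omega
    simp [toNat, ofNat, h1, h2]
  | witInp i =>
    have h1 : (10 * (i : ℕ) + 4) % 10 = 4 := by omega
    have h2 : (10 * (i : ℕ) + 4) / 10 = i := by omega
    simp [toNat, ofNat, h1, h2]
  | witAsg j =>
    have h1 : (10 * (j : ℕ) + 5) % 10 = 5 := by omega
    have h2 : (10 * (j : ℕ) + 5) / 10 = j := by omega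
    simp [toNat, ofNat, h1, h2]
  | witOut j =>
    have h1 : (10 * (j : ℕ) + 6) % 10 = 6 := by omega
    have h2 : (10 * (j : ℕ) + 6) / 10 = j := by omega
    simp [toNat, ofNat, h1, h2]
  | aux₁ v =>
    have h1 : (10 * v + 7) % 10 = 7 := by omega
    have h2 : (10 * v + 7) / 10 = v := by omega
    simp [toNat, ofNat, h1, h2]
  | aux₂ v =>
    have h1 : (10 * v + 8) % 10 = 8 := by omega
    have h2 : (10 * v + 8) / 10 = v := by omega
    simp [toNat, ofNat, h1, h2]
  | aux₃ v =>
    have h1 : (10 * v + 9) % 10 = 9 := by omega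
    have h2 : (10 * v + 9) / 10 = v := by omega
    simp [toNat, ofNat, h1, h2]

/-- The layout is injective. [folklore] -/
theorem toNat_injective : Function.Injective (toNat : WVar ℓ c n → ℕ) :=
  Function.LeftInverse.injective ofNat_toNat

end WVar

namespace WVar

variable {ℓ c n : ℕ}

/-- Gluing an assignment of the variables of `w^{k,u}_n(f)` from values `a, x, y` of the blocks
`A, X, Y` and assignments `τ₁, τ₂, τ₃` of the three run formulas (used for the completeness half
of the semantics). [folklore] -/
def glue (a : Fin ℓ → Bool) (x : Fin c → Bool) (y : Fin n → Bool)
    (τ₁ : RunVar (Fin ℓ ⊕ Fin c) (Fin n) → Bool) (τ₂ : RunVar (Fin ℓ) (Fin c ⊕ Fin n) → Bool)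
    (τ₃ : RunVar (Fin ℓ ⊕ Fin c) (Fin n) → Bool) : WVar ℓ c n → Bool
  | alg j => a j
  | inp i => x i
  | asg j => y j
  | out j => τ₁ (Sum.inr (Sum.inl j))
  | witInp i => τ₂ (Sum.inr (Sum.inl (Sum.inl i)))
  | witAsg j => τ₂ (Sum.inr (Sum.inl (Sum.inr j)))
  | witOut j => τ₃ (Sum.inr (Sum.inl j))
  | aux₁ v => τ₁ (Sum.inr (Sum.inr v))
  | aux₂ v => τ₂ (Sum.inr (Sum.inr v))
  | aux₃ v => τ₃ (Sum.inr (Sum.inr v))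

end WVar

/-! ### The formula `w^{k,u}_n(f)` -/

section Formula

variable {ℓ c n : ℕ}

/-- The witnessing formula over its structured variables: for the run formulas `RU` (of `U` on a
description block and a formula code, output an assignment; used for `C(X)` and for `C(f₁(C))`)
and `RF` (of `f` on the description block, outputs a formula code and an assignment) and the SAT
formula `S = SAT_n(·, ·)`,
`(R₁ ∧ R₂ ∧ R₃) → ([S(X,Y) → S(X,C(X))] ∨ [S(f₁(C),f₂(C)) ∧ ¬ S(f₁(C),C(f₁(C)))])`,
where `R₁, R₂, R₃` are `RU, RF, RU` relabelled onto the blocks of `WVar` (`WVar.run₁/₂/₃`) and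
`→` is `¬· ∨ ·`. [cite: PichSanthanam2026, §1.2 p. 6 and §3.2 p. 22 (w^{k,u}_n(f)); PichSanthanam2023 §1.1.1 (displayed formula)] -/
def psWitnessFormW (RU : PropForm (RunVar (Fin ℓ ⊕ Fin c) (Fin n)))
    (RF : PropForm (RunVar (Fin ℓ) (Fin c ⊕ Fin n))) (S : PropForm (Fin c ⊕ Fin n)) :
    PropForm (WVar ℓ c n) :=
  disj (neg (conj (RU.mapVars WVar.run₁) (conj (RF.mapVars WVar.run₂) (RU.mapVars WVar.run₃))))
    (disj (disj (neg (S.mapVars WVar.satXY)) (S.mapVars WVar.satXO))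
      (conj (S.mapVars WVar.satW) (neg (S.mapVars WVar.satWO))))

/-- **The Pich–Santhanam witnessing formula** `w^{k,u}_n(f)` as a formula over `ℕ` (the variable
type of the tree's Frege systems): `psWitnessFormW` laid out by `WVar.toNat`. Its parameters are
the propositional encodings of the two machines' runs and of `SAT_n`; see the module docstring
for the instantiation by `runForm`/`satMatrixForm` and why the choice of the universal machine
is immaterial. [cite: PichSanthanam2026, §1.2 p. 6 and §3.2 p. 22 (w^{k,u}_n(f))] -/
def psWitnessForm (RU : PropForm (RunVar (Fin ℓ ⊕ Fin c) (Fin n)))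
    (RF : PropForm (RunVar (Fin ℓ) (Fin c ⊕ Fin n))) (S : PropForm (Fin c ⊕ Fin n)) :
    PropForm ℕ :=
  (psWitnessFormW RU RF S).mapVars WVar.toNat

/-- The intended meaning of `w^{k,u}_n(f)` at one input length, for the semantics
`sat x y` ("assignment `y` satisfies the formula coded by `x`"), `gU` (the output of `U` within
the time budget on a description block and a formula code) and `gF` (the output of `f` on a
description block): for every description-plus-advice `a`, code `x` and assignment `y`, either
`sat x y → sat x (U(a, x))`, or `f(a) = (f₁, f₂)` satisfies `sat f₁ f₂ ∧ ¬ sat f₁ (U(a, f₁))` —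
"`f` witnesses errors of `n^k`-time algorithms described by `log n` bits with `u(n)` bits of
advice attempting to solve the search version of SAT". [cite: PichSanthanam2026, §3.2 p. 22] -/
def SearchSATWitnessing (sat : (Fin c → Bool) → (Fin n → Bool) → Bool)
    (gU : (Fin ℓ ⊕ Fin c → Bool) → Fin n → Bool) (gF : (Fin ℓ → Bool) → Fin c ⊕ Fin n → Bool) :
    Prop :=
  ∀ (a : Fin ℓ → Bool) (x : Fin c → Bool) (y : Fin n → Bool),
    (sat x y = true → sat x (gU (Sum.elim a x)) = true) ∨
    (sat (fun i => gF a (Sum.inl i)) (fun j => gF a (Sum.inr j)) = true ∧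
      sat (fun i => gF a (Sum.inl i)) (gU (Sum.elim a fun i => gF a (Sum.inl i))) = false)

variable (RU : PropForm (RunVar (Fin ℓ ⊕ Fin c) (Fin n)))
  (RF : PropForm (RunVar (Fin ℓ) (Fin c ⊕ Fin n))) (S : PropForm (Fin c ⊕ Fin n))

/-- The size of `w^{k,u}_n(f)` is linear in the sizes of its constituents. [folklore] -/
theorem size_psWitnessForm :
    (psWitnessForm RU RF S).size = 2 * RU.size + RF.size + 4 * S.size + 9 := by
  simp only [psWitnessForm, psWitnessFormW, size_mapVars, size]
  ring

/-- Truth value of the structured witnessing formula. [folklore] -/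
theorem eval_psWitnessFormW (τ : WVar ℓ c n → Bool) :
    (psWitnessFormW RU RF S).eval τ =
      (!(RU.eval (τ ∘ WVar.run₁) && (RF.eval (τ ∘ WVar.run₂) && RU.eval (τ ∘ WVar.run₃))) ||
        ((!S.eval (τ ∘ WVar.satXY) || S.eval (τ ∘ WVar.satXO)) ||
          (S.eval (τ ∘ WVar.satW) && !S.eval (τ ∘ WVar.satWO)))) := by
  simp only [psWitnessFormW, eval, eval_mapVars]

/-- The Boolean shape of the consequent of `w^{k,u}_n(f)`. [folklore] -/
theorem bool_consequent_iff (b₁ b₂ b₃ b₄ : Bool) :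
    ((!b₁ || b₂) || (b₃ && !b₄)) = true ↔ ((b₁ = true → b₂ = true) ∨ (b₃ = true ∧ b₄ = false)) := by
  cases b₁ <;> cases b₂ <;> cases b₃ <;> cases b₄ <;> decide

variable {RU RF S}
  {gU : (Fin ℓ ⊕ Fin c → Bool) → Fin n → Bool} {gF : (Fin ℓ → Bool) → Fin c ⊕ Fin n → Bool}
  {sat : (Fin c → Bool) → (Fin n → Bool) → Bool}

/-- Under an assignment satisfying the three run formulas, the output blocks carry the intended
values `C(X) = U(A, X)`, `(f₁, f₂) = f(A)`, `C(f₁) = U(A, f₁)`. [cite: PichSanthanam2026, §3.2 p. 22] -/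
theorem outputs_of_runs (hU : DefinesMap RU gU) (hF : DefinesMap RF gF) (τ : WVar ℓ c n → Bool)
    (a : Fin ℓ → Bool) (x : Fin c → Bool)
    (ha : (fun j => τ (WVar.alg j)) = a) (hx : (fun i => τ (WVar.inp i)) = x)
    (h₁ : RU.eval (τ ∘ WVar.run₁) = true) (h₂ : RF.eval (τ ∘ WVar.run₂) = true)
    (h₃ : RU.eval (τ ∘ WVar.run₃) = true) :
    (fun j => τ (WVar.out j)) = gU (Sum.elim a x) ∧
    (fun i => τ (WVar.witInp i)) = (fun i => gF a (Sum.inl i)) ∧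
    (fun j => τ (WVar.witAsg j)) = (fun j => gF a (Sum.inr j)) ∧
    (fun j => τ (WVar.witOut j)) = gU (Sum.elim a fun i => gF a (Sum.inl i)) := by
  subst ha hx
  have e₁ : (fun j => (τ ∘ WVar.run₁) (Sum.inl j)) =
      Sum.elim (fun j => τ (WVar.alg j)) (fun i => τ (WVar.inp i)) := by
    funext j; rcases j with j | i <;> rfl
  have e₂ : (fun j => (τ ∘ WVar.run₂) (Sum.inl j)) = fun j => τ (WVar.alg j) := rfl
  have ho : (fun j => τ (WVar.out j)) =
      gU (Sum.elim (fun j => τ (WVar.alg j)) (fun i => τ (WVar.inp i))) := by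
    funext j
    have := hU.1 _ h₁ j
    rwa [e₁] at this
  have hwi : (fun i => τ (WVar.witInp i)) = fun i => gF (fun j => τ (WVar.alg j)) (Sum.inl i) := by
    funext i
    have := hF.1 _ h₂ (Sum.inl i)
    rwa [e₂] at this
  have hwa : (fun j => τ (WVar.witAsg j)) = fun j => gF (fun j => τ (WVar.alg j)) (Sum.inr j) := by
    funext j
    have := hF.1 _ h₂ (Sum.inr j)
    rwa [e₂] at this
  have e₃ : (fun j => (τ ∘ WVar.run₃) (Sum.inl j)) =
      Sum.elim (fun j => τ (WVar.alg j)) (fun i => gF (fun j => τ (WVar.alg j)) (Sum.inl i)) := by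
    funext j
    rcases j with j | i
    · rfl
    · exact congrFun hwi i
  have hwo : (fun j => τ (WVar.witOut j)) =
      gU (Sum.elim (fun j => τ (WVar.alg j)) fun i => gF (fun j => τ (WVar.alg j)) (Sum.inl i)) := by
    funext j
    have := hU.1 _ h₃ j
    rwa [e₃] at this
  exact ⟨ho, hwi, hwa, hwo⟩

/-- **Semantics of the witnessing formula (structured variables).** If `RU`, `RF` define the maps
`gU`, `gF` and `S` expresses `sat`, then `psWitnessFormW RU RF S` is a tautology iff the
witnessing statement `SearchSATWitnessing sat gU gF` holds. [cite: PichSanthanam2026, §1.2 p. 6 ("Intuitively, w^k_n(f) states that …"), §3.2 p. 22] -/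
theorem isTautology_psWitnessFormW_iff (hU : DefinesMap RU gU) (hF : DefinesMap RF gF)
    (hS : ∀ τ, S.eval τ = sat (fun i => τ (Sum.inl i)) (fun j => τ (Sum.inr j))) :
    (psWitnessFormW RU RF S).IsTautology ↔ SearchSATWitnessing sat gU gF := by
  constructor
  · intro h a x y
    -- glue an assignment from satisfying assignments of the three runs
    obtain ⟨τ₁, hτ₁, hi₁⟩ := hU.2 (Sum.elim a x)
    obtain ⟨τ₂, hτ₂, hi₂⟩ := hF.2 a
    have ha₂ : (fun j => τ₂ (Sum.inl j)) = a := funext hi₂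
    have hwit : ∀ i, τ₂ (Sum.inr (Sum.inl i)) = gF a i := fun i => by rw [hF.1 _ hτ₂ i, ha₂]
    obtain ⟨τ₃, hτ₃, hi₃⟩ := hU.2 (Sum.elim a fun i => gF a (Sum.inl i))
    let τ : WVar ℓ c n → Bool := WVar.glue a x y τ₁ τ₂ τ₃
    have hr₁ : τ ∘ WVar.run₁ = τ₁ := by
      funext v
      rcases v with (j | i) | (j | v)
      · exact (hi₁ (Sum.inl j)).symm
      · exact (hi₁ (Sum.inr i)).symm
      · rfl
      · rfl
    have hr₂ : τ ∘ WVar.run₂ = τ₂ := by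
      funext v
      rcases v with j | ((i | j) | v)
      · exact (hi₂ j).symm
      · rfl
      · rfl
      · rfl
    have hr₃ : τ ∘ WVar.run₃ = τ₃ := by
      funext v
      rcases v with (j | i) | (j | v)
      · exact (hi₃ (Sum.inl j)).symm
      · exact (hwit (Sum.inl i)).trans (hi₃ (Sum.inr i)).symm
      · rfl
      · rfl
    have hev := h τ
    rw [eval_psWitnessFormW, hr₁, hr₂, hr₃, hτ₁, hτ₂, hτ₃] at hev
    obtain ⟨ho, hwi, hwa, hwo⟩ := outputs_of_runs hU hF τ a x rfl rfl
      (by rw [hr₁]; exact hτ₁) (by rw [hr₂]; exact hτ₂) (by rw [hr₃]; exact hτ₃)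
    have exy : S.eval (τ ∘ WVar.satXY) = sat x y := hS _
    have exo : S.eval (τ ∘ WVar.satXO) = sat x (gU (Sum.elim a x)) := by
      rw [hS]
      show sat x (fun j => τ (WVar.out j)) = _
      rw [ho]
    have ew : S.eval (τ ∘ WVar.satW) =
        sat (fun i => gF a (Sum.inl i)) (fun j => gF a (Sum.inr j)) := by
      rw [hS]
      show sat (fun i => τ (WVar.witInp i)) (fun j => τ (WVar.witAsg j)) = _
      rw [hwi, hwa]
    have ewo : S.eval (τ ∘ WVar.satWO) =
        sat (fun i => gF a (Sum.inl i)) (gU (Sum.elim a fun i => gF a (Sum.inl i))) := by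
      rw [hS]
      show sat (fun i => τ (WVar.witInp i)) (fun j => τ (WVar.witOut j)) = _
      rw [hwi, hwo]
    rw [exy, exo, ew, ewo] at hev
    simp only [Bool.true_and, Bool.not_true, Bool.false_or] at hev
    exact (bool_consequent_iff _ _ _ _).1 hev
  · intro h τ
    rw [eval_psWitnessFormW]
    cases h₁ : RU.eval (τ ∘ WVar.run₁)
    · simp
    cases h₂ : RF.eval (τ ∘ WVar.run₂)
    · simp
    cases h₃ : RU.eval (τ ∘ WVar.run₃)
    · simp
    simp only [Bool.true_and, Bool.not_true, Bool.false_or]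
    obtain ⟨ho, hwi, hwa, hwo⟩ := outputs_of_runs hU hF τ _ _ rfl rfl h₁ h₂ h₃
    have exy : S.eval (τ ∘ WVar.satXY) =
        sat (fun i => τ (WVar.inp i)) (fun j => τ (WVar.asg j)) := hS _
    have exo : S.eval (τ ∘ WVar.satXO) = sat (fun i => τ (WVar.inp i))
        (gU (Sum.elim (fun j => τ (WVar.alg j)) fun i => τ (WVar.inp i))) := by
      rw [hS]
      show sat (fun i => τ (WVar.inp i)) (fun j => τ (WVar.out j)) = _
      rw [ho]
    have ew : S.eval (τ ∘ WVar.satW) = sat (fun i => gF (fun j => τ (WVar.alg j)) (Sum.inl i))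
        (fun j => gF (fun j => τ (WVar.alg j)) (Sum.inr j)) := by
      rw [hS]
      show sat (fun i => τ (WVar.witInp i)) (fun j => τ (WVar.witAsg j)) = _
      rw [hwi, hwa]
    have ewo : S.eval (τ ∘ WVar.satWO) = sat (fun i => gF (fun j => τ (WVar.alg j)) (Sum.inl i))
        (gU (Sum.elim (fun j => τ (WVar.alg j))
          fun i => gF (fun j => τ (WVar.alg j)) (Sum.inl i))) := by
      rw [hS]
      show sat (fun i => τ (WVar.witInp i)) (fun j => τ (WVar.witOut j)) = _
      rw [hwi, hwo]
    rw [exy, exo, ew, ewo]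
    exact (bool_consequent_iff _ _ _ _).2
      (h (fun j => τ (WVar.alg j)) (fun i => τ (WVar.inp i)) (fun j => τ (WVar.asg j)))

/-- **Semantics of the witnessing formula.** If `RU`, `RF` define `gU`, `gF` and `S` expresses
`sat`, then `psWitnessForm RU RF S` is a tautology iff `SearchSATWitnessing sat gU gF` — for the
instantiation by the runs of `U` (budget `n^k`) and of the machine of `f` and by `SAT_n`: iff `f`
witnesses, at length `n`, the errors of every `⌊log n⌋ + u(n)`-bit description-plus-advice run by
`U` for `n^k` steps as a search-SAT algorithm. [cite: PichSanthanam2026, §1.2 p. 6, §3.2 p. 22] -/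
theorem isTautology_psWitnessForm_iff (hU : DefinesMap RU gU) (hF : DefinesMap RF gF)
    (hS : ∀ τ, S.eval τ = sat (fun i => τ (Sum.inl i)) (fun j => τ (Sum.inr j))) :
    (psWitnessForm RU RF S).IsTautology ↔ SearchSATWitnessing sat gU gF := by
  rw [psWitnessForm, isTautology_mapVars_iff WVar.ofNat_toNat,
    isTautology_psWitnessFormW_iff hU hF hS]

/-- In particular the witnessing formula is a tautology as soon as the witnessing statement
holds (the hypothesis under which `EF + w` is introduced and is sound,
`isTautology_of_mem_efPlus`). [cite: PichSanthanam2026, §1.2 p. 7] -/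
theorem isTautology_psWitnessForm (hU : DefinesMap RU gU) (hF : DefinesMap RF gF)
    (hS : ∀ τ, S.eval τ = sat (fun i => τ (Sum.inl i)) (fun j => τ (Sum.inr j)))
    (h : SearchSATWitnessing sat gU gF) : (psWitnessForm RU RF S).IsTautology :=
  (isTautology_psWitnessForm_iff hU hF hS).2 h

end Formula

/-! ## 3. Corollary 20 (self-provability for uniform algorithms), encoding-generic -/

/-- A *witnessing frame*: for every input length `n`, the data from which `w^{k,u}_n(f)` is
assembled — the description length `descLen n` (`= ⌊log n⌋ + u(n)`), the code length
`codeLen n`, the run formula `runU n` of the universal machine (budget `n^k`) on a description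
and a code, the run formula `runF n` of the machine of `f` on a description, the formula
`satForm n = SAT_n`, together with their INTENDED semantics `evalU n`, `evalF n`, `sat n`
(correctness is the separate predicate `WitnessingFrame.Correct`). It packages the parameters
`k, u, f, U` and the encodings of Pich–Santhanam's "Restricting nonuniformity".
[cite: PichSanthanam2026, §3.2 p. 22 (Restricting nonuniformity)] -/
structure WitnessingFrame where
  /-- length of the description-plus-advice block at input length `n` (`⌊log n⌋ + u(n)`) -/
  descLen : ℕ → ℕ
  /-- length of formula codes at input length `n` -/
  codeLen : ℕ → ℕ
  /-- the run formula of `U` on `(A, X)` for the time budget at length `n` -/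
  runU : ∀ n, PropForm (RunVar (Fin (descLen n) ⊕ Fin (codeLen n)) (Fin n))
  /-- the run formula of the machine of `f` on `A` (and the constant `1ⁿ`) -/
  runF : ∀ n, PropForm (RunVar (Fin (descLen n)) (Fin (codeLen n) ⊕ Fin n))
  /-- the formula `SAT_n(X, Y)` -/
  satForm : ∀ n, PropForm (Fin (codeLen n) ⊕ Fin n)
  /-- intended semantics of `runU n`: the output of `U` within the budget -/
  evalU : ∀ n, (Fin (descLen n) ⊕ Fin (codeLen n) → Bool) → Fin n → Bool
  /-- intended semantics of `runF n`: the output `(f₁, f₂)` of `f` -/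
  evalF : ∀ n, (Fin (descLen n) → Bool) → Fin (codeLen n) ⊕ Fin n → Bool
  /-- intended semantics of `satForm n`: `y` satisfies the formula coded by `x` -/
  sat : ∀ n, (Fin (codeLen n) → Bool) → (Fin n → Bool) → Bool

namespace WitnessingFrame

/-- The frame is *correct*: each run formula defines its intended map and `satForm n` expresses
`sat n`. [cite: PichSanthanam2026, §3.2 p. 22] -/
def Correct (W : WitnessingFrame) : Prop :=
  (∀ n, DefinesMap (W.runU n) (W.evalU n)) ∧ (∀ n, DefinesMap (W.runF n) (W.evalF n)) ∧
    ∀ n (τ : Fin (W.codeLen n) ⊕ Fin n → Bool),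
      (W.satForm n).eval τ = W.sat n (fun i => τ (Sum.inl i)) (fun j => τ (Sum.inr j))

/-- The witnessing formula `w^{k,u}_n(f)` of the frame at length `n`. [cite: PichSanthanam2026, §3.2 p. 22] -/
def form (W : WitnessingFrame) (n : ℕ) : PropForm ℕ :=
  psWitnessForm (W.runU n) (W.runF n) (W.satForm n)

/-- `W.SolvesAt a n`: at length `n`, the description-plus-advice `a n`, run by `U` within the
budget, solves the search version of SAT on codes of length `codeLen n`: whenever `y` satisfies
`x`, so does `U(a n, x)`. Membership of SAT in Pich–Santhanam's `Time[n^k]/u(n)` (via `U`) is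
`∃ a n₁, ∀ n ≥ n₁, W.SolvesAt a n`. [cite: PichSanthanam2026, §3.2 p. 22 (Time[n^k]/u(n))] -/
def SolvesAt (W : WitnessingFrame) (a : ∀ n, Fin (W.descLen n) → Bool) (n : ℕ) : Prop :=
  ∀ (x : Fin (W.codeLen n) → Bool) (y : Fin n → Bool),
    W.sat n x y = true → W.sat n x (W.evalU n (Sum.elim (a n) x)) = true

/-- **SAT-adequacy** of the frame's `SAT_n` encoding over the rule list `F` — the step "To prove a
tautology `φ` of size `n` in `EF + w^k(f)` it suffices to check out that `¬SAT_n(¬φ, C(¬φ))`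
(which implies that `SAT_n(φ, y)` and `φ` hold)" of the printed proof, made explicit for an
abstract encoding: with polynomial slack `q`, every tautology `ψ` has, at some length `n` between
any prescribed `N` and `q(|ψ| + N)`, a code `x` of an unsatisfiable formula (`sat n x · ≡ false`;
intended: the padded code of a CNF of `¬ψ`) and formulas `ν` for the assignment variables
(intended: the subformulas of `¬ψ` abbreviated by the CNF's variables) such that `F` has a Frege
proof of `SAT_n(x, ν) ∨ ψ` of size `≤ q(|ψ| + N)`. For the matrix-code `SAT_n` this is the
evaluation of `SAT_n` at a constant code followed by Tseitin's biimplications.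
[cite: PichSanthanam2026, §3.2 p. 22 (proof of Thm 19, last step)] -/
def SatAdequate (W : WitnessingFrame) (F : FregeSystem) : Prop :=
  ∃ q : Polynomial ℕ, ∀ ψ : PropForm ℕ, ψ.IsTautology → ∀ N : ℕ,
    ∃ n, N ≤ n ∧ n ≤ q.eval (ψ.size + N) ∧
      ∃ (x : Fin (W.codeLen n) → Bool) (ν : Fin n → PropForm ℕ),
        (∀ y, W.sat n x y = false) ∧
        ∃ π, F.IsProofOf π (disj ((W.satForm n).bind (Sum.elim (fun i => const (x i)) ν)) ψ) ∧
          proofSize π ≤ q.eval (ψ.size + N)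

variable {W : WitnessingFrame}

/-- Semantics of the frame's witnessing formulas. [cite: PichSanthanam2026, §3.2 p. 22] -/
theorem isTautology_form_iff (hW : W.Correct) (n : ℕ) :
    (W.form n).IsTautology ↔ SearchSATWitnessing (W.sat n) (W.evalU n) (W.evalF n) :=
  isTautology_psWitnessForm_iff (hW.1 n) (hW.2.1 n) (hW.2.2 n)

/-- A description-plus-advice that solves search-SAT at length `n` "falsif[ies] the right
disjunct in `w^k_n(f)`": `f(a)` is then no counterexample. This dichotomy drives Cor. 20.
[cite: PichSanthanam2026, §3.2 p. 22 (proof of Thm 19)] -/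
theorem SolvesAt.not_right_disjunct {a : ∀ n, Fin (W.descLen n) → Bool} {n : ℕ}
    (ha : W.SolvesAt a n) :
    ¬ (W.sat n (fun i => W.evalF n (a n) (Sum.inl i)) (fun j => W.evalF n (a n) (Sum.inr j)) =
          true ∧
        W.sat n (fun i => W.evalF n (a n) (Sum.inl i))
          (W.evalU n (Sum.elim (a n) fun i => W.evalF n (a n) (Sum.inl i))) = false) := by
  rintro ⟨h1, h2⟩
  rw [ha _ _ h1] at h2
  exact Bool.noConfusion h2

end WitnessingFrame

/-- **Pich–Santhanam, Corollary 20 ("Circuit complexity from proof complexity & witnessing of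
P ≠ NP"), encoding-generic, both items unified over an axiom set.** Printed (J. ACM p. 22): "Let
`k ≥ 1` be a constant and `u` a p-time function such that `u(n) ≤ n^k`. (1) Suppose that there is
a p-time function `f` such that for each big enough `n`, `w^{k,u}_n(f)` is a tautology. If
`EF + w^{k,u}(f)` is not p-bounded, then `SAT ∉ Time[n^{Ω(k)}]/u(n)`. (2) Suppose that there is a
p-time function `f` such that for some `n₀`, `S¹₂ ⊢ W^{k,u}_{n₀}(f)`. If EF is not p-bounded,
then `SAT ∉ Time[n^{Ω(k)}]/u(n)`", where for (2) "A reader uncomfortable with bounded arithmetic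
can instead of `S¹₂`-proofs imagine p-size EF-proofs of `w^k_n(f)` … the statement remains
valid" (p. 7), and with the printed proof (of Thm 19, which "works in this case as well"):
a correct algorithm falsifies the right disjunct, so the system proves
`SAT_n(x,y) → SAT_n(x,C(x))` efficiently, hence is p-bounded since "To prove a tautology `φ` of
size `n` … it suffices to check out that `¬SAT_n(¬φ, C(¬φ))`".
Here: for every Frege rule list `F`, every substitution-closed axiom set `Γ` (item 1:
`Γ = efPlus w n₀`; item 2: `Γ = ∅`; see `PSUniformSelfProvability.cor20_1/2`), every correct
witnessing frame `W` (the encodings of `U` with budget `n^k`, of `f`, and of `SAT_n`; `k, u`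
absorbed) whose `SAT_n` is adequate over `F` (the quoted last step, explicit): if `EF + Γ` has
proofs of `w^{k,u}_n(f)` of size `poly(n)` for `n ≥ n₀` and `EF + Γ` is not p-bounded, then no
description-plus-advice sequence `a` is a correct search-SAT algorithm (as run by `U` within the
budget) at all large lengths — the form of `SAT ∉ Time[n^k]/u(n)` the proof delivers (the
passage to `n^{Ω(k)}`-time multitape machines is the overhead of `U`, not formalised here).
[cite: PichSanthanam2026, Cor. 20 p. 22 (with the proof of Thm 19, p. 22, and the remark on p. 7)] -/
def PSUniformSelfProvability : Prop :=
  ∀ (F : FregeSystem), IsFrege F →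
  ∀ (Γ : Set (PropForm ℕ)), (∀ θ ∈ Γ, ∀ σ : ℕ → PropForm ℕ, θ.subst σ ∈ Γ) →
  ∀ (W : WitnessingFrame), W.Correct → W.SatAdequate F →
  ∀ n₀ : ℕ, (∃ p : Polynomial ℕ, ∀ n, n₀ ≤ n →
      ∃ π, F.IsEFProofFromOf Γ π (W.form n) ∧ proofSize π ≤ p.eval n) →
    ¬ F.IsEFPolyBoundedFrom Γ →
    ∀ (a : ∀ n, Fin (W.descLen n) → Bool) (N : ℕ), ∃ n, N ≤ n ∧ ¬ W.SolvesAt a n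

/-- **Corollary 20 (2)** from `PSUniformSelfProvability` (`Γ = ∅`): if EF has `poly(n)`-size
proofs of `w^{k,u}_n(f)` for `n ≥ n₀` and EF is not p-bounded (`¬ F.IsEFPolyBounded`, the open
lower bound pnp.S32 at `F`), then every description-plus-advice sequence fails as a search-SAT
algorithm at infinitely many lengths. [cite: PichSanthanam2026, Cor. 20 (2) p. 22] -/
theorem PSUniformSelfProvability.cor20_2 (hPS : PSUniformSelfProvability) {F : FregeSystem}
    (hF : IsFrege F) {W : WitnessingFrame} (hW : W.Correct) (hA : W.SatAdequate F) {n₀ : ℕ}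
    (hproofs : ∃ p : Polynomial ℕ, ∀ n, n₀ ≤ n →
      ∃ π, F.IsEFProofOf π (W.form n) ∧ proofSize π ≤ p.eval n)
    (hEF : ¬ F.IsEFPolyBounded) (a : ∀ n, Fin (W.descLen n) → Bool) (N : ℕ) :
    ∃ n, N ≤ n ∧ ¬ W.SolvesAt a n := by
  refine hPS F hF ∅ (fun θ hθ _ => absurd hθ (Set.notMem_empty θ)) W hW hA n₀ ?_ ?_ a N
  · obtain ⟨p, hp⟩ := hproofs
    exact ⟨p, fun n hn => (hp n hn).imp fun π hπ =>
      ⟨FregeSystem.isEFProofFromOf_empty.2 hπ.1, hπ.2⟩⟩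
  · rwa [FregeSystem.isEFPolyBoundedFrom_empty]

/-- **Corollary 20 (1)** from `PSUniformSelfProvability` (`Γ = efPlus w n₀`, the axioms of
`EF + w^{k,u}(f)`, which prove each `w^{k,u}_n(f)`, `n > n₀`, in one line): if the witnessing
formulas have size `poly(n)` and `EF + w^{k,u}(f)` is not p-bounded, then every
description-plus-advice sequence fails as a search-SAT algorithm at infinitely many lengths.
The printed standing hypothesis that the `w^{k,u}_n(f)`, `n > n₀`, are tautologies (which makes
`EF + w` a sound proof system, `isTautology_of_mem_efPlus`) is not needed for the implication
and therefore omitted. [cite: PichSanthanam2026, Cor. 20 (1) p. 22] -/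
theorem PSUniformSelfProvability.cor20_1 (hPS : PSUniformSelfProvability) {F : FregeSystem}
    (hF : IsFrege F) {W : WitnessingFrame} (hW : W.Correct) (hA : W.SatAdequate F) {n₀ : ℕ}
    (hsize : ∃ p : Polynomial ℕ, ∀ n, (W.form n).size ≤ p.eval n)
    (hEFw : ¬ F.IsEFPolyBoundedFrom (efPlus W.form n₀)) (a : ∀ n, Fin (W.descLen n) → Bool)
    (N : ℕ) : ∃ n, N ≤ n ∧ ¬ W.SolvesAt a n := by
  refine hPS F hF (efPlus W.form n₀) (fun θ hθ σ => subst_mem_efPlus hθ σ) W hW hA (n₀ + 1)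
    ?_ hEFw a N
  obtain ⟨p, hp⟩ := hsize
  exact ⟨p, fun n hn => ⟨[W.form n], FregeSystem.isEFProofFromOf_singleton (mem_efPlus hn),
    by simpa [proofSize] using hp n⟩⟩

end Literature.Computability.MetaComplexity
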